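import Summits.RiemannHypothesis.RiemannHypothesis.Theorems.SemilocalDeletionToeplitzFloor
import Summits.RiemannHypothesis.RiemannHypothesis.Theorems.HandoffSemilocalParitySplit
import Literature.NumberTheory.LFunctions.WeilSmallSupportPositivity
import Literature.NumberTheory.LFunctions.WeilWindowSimpleEven
import Literature.NumberTheory.LFunctions.WeilMellinBounds
import HarnessLib

/-!
# The `(m+1)`-block HALF-ROOM LAW of the Toeplitz floor: `λ_min(S∖p; mL/2 + δ) ≤ (vᵀA_m(p)v)/|v|² + 2^m·λ_min(S; δ)` for EVERY comb `v`

`SemilocalDeletionToeplitzFloor.lean` proves the floor `λ_min(S∖p; c; P) ≥ λ_min(S; c; P) + λ_min(A_m(p))` for a prime `p` with `m` visible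
powers (`A_m(p) = [log p·p^{−|i−j|/2}]_{i≠j}`, zero diagonal).  This file proves the CONVERGENCE half for every `m ≥ 1` in the form the cell's
certificates use: on the window `c = m·L/2 + δ` (`L = log p`, `0 < δ`, `2δ < L`: exactly `p, …, p^m` visible), under ONE rung `Q_S ≥ 0` on `C(c)`,
for every coefficient vector `v = (v_0, …, v_m)` and every block `h ∈ C(δ)`, the COMB `g_v = Σ_i v_i·h(· − x_i)`, `x_i = iL − mL/2`, satisfies

* `‖g_v‖₂² = |v|²‖h‖₂²` and `Q_{S∖p}(g_v) = Q_S(g_v) + (vᵀA_m(p)v)·‖h‖₂²` EXACTLY — by the cell/fibre lemmas of `SemilocalDeletionToeplitzFloor`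
  (the comb's fibre vector over the base cell is `h(w + c − δ)·v`: `comb_apply_cell`), no pairwise bookkeeping;
* `Re Q_S(g_v) ≤ 2^m·|v|²·Re Q_S(h)` — the parallelogram law `m` times with positivity of every `Q_S(F − u)` (§2);
* hence **`λ_min(S∖{p}; mL/2 + δ)·|v|² ≤ vᵀA_m(p)v + 2^m·|v|²·λ_min(S; δ)`** (`semilocalGroundEnergy_erase_top_le_comb`): plugging the
  bottom eigenvector gives `λ_min(S∖p) ≤ λ_min(A_m(p)) + 2^m·ε^S(δ)`; any rational `v` near it gives a certified upper end.  `m = 1` is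
  `SemilocalDeletionDipoleHalfRoom` (factor 2), `m = 2` with the exact eigenvector is `SemilocalDeletionToeplitzHalfRoom` (factor 4).

So the Toeplitz law of lineage E — `λ(U(b)∖{p}; b) = λ_min(A_m(p)) + Δ`, `0 ≤ Δ → 0` with the room `b − m·log p/2` (PREREG-ccs21-g12-toeplitz20,
28/28 BLIND; p = 2, m = 5: `Δ = 5.4e−5` at `b = 2`) — is two-sided for every `m`: `0 ≤ Δ_σ ≤ 2^m·ε(δ) + (vᵀA v/|v|² − λ_min(A))`.
Nothing here bears on RH.
-/

set_option linter.dupNamespace false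

noncomputable section

open Complex Filter Set MeasureTheory
open scoped Real Topology ComplexConjugate

namespace Summit.RiemannHypothesis.RiemannHypothesis.Theorems.SemilocalDeletionToeplitzCombs

open Literature.NumberTheory.LFunctions
open Summit.RiemannHypothesis.RiemannHypothesis.Theorems.HandoffSemilocalEnergy
open Summit.RiemannHypothesis.RiemannHypothesis.Theorems.HandoffSemilocalParitySplit
open Summit.RiemannHypothesis.RiemannHypothesis.Theorems.SemilocalDeletionToeplitzFloor

variable {h f g : ℝ → ℂ} {S : Finset ℕ} {p : ℕ} {δ L c a : ℝ} {P : (ℝ → ℂ) → Prop} {v : ℕ → ℝ}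

/-! ## §1  Combs of translates: test functions, support, values on the cells -/

/-- The partial combs `F_n = Σ_{i<n} v_i·h(· + a − iL)` are test functions. -/
theorem isWeilTest_comb (hh : IsWeilTest h) (v : ℕ → ℝ) (a L : ℝ) :
    ∀ n : ℕ, IsWeilTest fun t ↦ ∑ i ∈ Finset.range (n + 1), (v i : ℂ) * h (t + a - i * L) := by
  intro n
  induction n with
  | zero =>
    simp only [zero_add, Finset.range_one, Finset.sum_singleton, Nat.cast_zero, zero_mul, sub_zero]
    exact (isWeilTest_translate hh a).const_mul (v 0)
  | succ n ih =>
    have hu : IsWeilTest fun t ↦ (v (n + 1) : ℂ) * h (t + a - ((n + 1 : ℕ) : ℝ) * L) := by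
      have := (isWeilTest_translate hh (a - ((n + 1 : ℕ) : ℝ) * L)).const_mul (v (n + 1) : ℂ)
      simp only [← add_sub_assoc] at this
      exact this
    have e : (fun t ↦ ∑ i ∈ Finset.range (n + 1 + 1), (v i : ℂ) * h (t + a - i * L)) =
        (fun t ↦ ∑ i ∈ Finset.range (n + 1), (v i : ℂ) * h (t + a - i * L)) +
          fun t ↦ (v (n + 1) : ℂ) * h (t + a - ((n + 1 : ℕ) : ℝ) * L) := by
      funext t; rw [Finset.sum_range_succ, Pi.add_apply]
    rw [e]
    exact ih.add hu

/-- Support of a partial comb: with `h ∈ C(δ)`, `L ≥ 0`, `n ≤ m`, the comb `Σ_{i≤n} v_i h(t + mL/2 − iL)` lives in `[−(mL/2 + δ), mL/2 + δ]`. -/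
theorem tsupport_comb_subset (hsupp : tsupport h ⊆ Icc (-δ) δ) (hL : 0 ≤ L) (v : ℕ → ℝ) {m n : ℕ} (hn : n ≤ m) :
    tsupport (fun t ↦ ∑ i ∈ Finset.range (n + 1), (v i : ℂ) * h (t + m * L / 2 - i * L)) ⊆
      Icc (-(m * L / 2 + δ)) (m * L / 2 + δ) := by
  refine (isClosed_Icc.closure_subset_iff).2 fun t ht' ↦ ?_
  have ht := Function.mem_support.1 ht'
  obtain ⟨i, hi, hne⟩ := Finset.exists_ne_zero_of_sum_ne_zero ht
  have hi' : (i : ℝ) ≤ m := by exact_mod_cast (Nat.lt_succ_iff.1 (Finset.mem_range.1 hi)).trans hn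
  have h0 : (0 : ℝ) ≤ i := by exact_mod_cast Nat.zero_le i
  have := hsupp (subset_tsupport _ (Function.mem_support.2 (right_ne_zero_of_mul hne)))
  rw [mem_Icc] at this ⊢
  constructor <;> nlinarith [this.1, this.2]

/-- **Values on the cells.** With `c = mL/2 + δ`, `2δ < L`, `h ∈ C(δ)`, coefficients vanishing beyond `m`, and a base point
`w ∈ [−c, −c + L)`: the comb at `w + nL` is the single block `n`: `g(w + nL) = v_n·h(w + c − δ)` (every other block is `≥ L − 2δ` away). -/
theorem comb_apply_cell (hsupp : tsupport h ⊆ Icc (-δ) δ) (hL : 2 * δ < L) {m : ℕ} (hv : ∀ j, m < j → v j = 0) {w : ℝ}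
    (hw : w ∈ Ico (-(m * L / 2 + δ)) (-(m * L / 2 + δ) + L)) (n : ℕ) :
    ∑ i ∈ Finset.range (m + 1), (v i : ℂ) * h (w + n * L + m * L / 2 - i * L) = (v n : ℂ) * h (w + (m * L / 2 + δ) - δ) := by
  rw [mem_Ico] at hw
  have hzero : ∀ i ∈ Finset.range (m + 1), i ≠ n → (v i : ℂ) * h (w + n * L + m * L / 2 - i * L) = 0 := by
    intro i _ hin
    suffices h0 : h (w + n * L + m * L / 2 - i * L) = 0 by rw [h0, mul_zero]
    by_contra hne
    have := hsupp (subset_tsupport _ (Function.mem_support.2 hne))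
    rw [mem_Icc] at this
    rcases lt_or_gt_of_ne hin with hlt | hgt
    · have : (i : ℝ) + 1 ≤ n := by exact_mod_cast hlt
      nlinarith [this]
    · have : (n : ℝ) + 1 ≤ i := by exact_mod_cast hgt
      nlinarith [this]
  by_cases hn : n ∈ Finset.range (m + 1)
  · rw [Finset.sum_eq_single_of_mem n hn fun i hi hin ↦ hzero i hi hin]
    congr 2; ring
  · rw [Finset.sum_eq_zero fun i hi ↦ hzero i hi (fun e ↦ hn (e ▸ hi)),
      hv n (by simpa [Finset.mem_range, Nat.lt_succ_iff] using hn)]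
    simp

/-- `∫_{[−c, −c+L)} |h(w + c − δ)|² dw = ‖h‖₂²`: the shifted block sits inside the base cell (`2δ < L`). -/
theorem setIntegral_norm_sq_shift (hsupp : tsupport h ⊆ Icc (-δ) δ) (hL : 2 * δ < L) (c : ℝ) :
    ∫ w in Ico (-c) (-c + L), ‖h (w + c - δ)‖ ^ 2 = ∫ u : ℝ, ‖h u‖ ^ 2 := by
  have hδ : 0 ≤ δ ∨ tsupport h = ∅ := by
    rcases (tsupport h).eq_empty_or_nonempty with h0 | ⟨t, ht⟩
    · exact Or.inr h0
    · have := hsupp ht; rw [mem_Icc] at this; exact Or.inl (by linarith)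
  have hvan : ∀ w, w ∉ Ico (-c) (-c + L) → ‖h (w + c - δ)‖ ^ 2 = 0 := by
    intro w hw
    suffices h0 : h (w + c - δ) = 0 by rw [h0, norm_zero, zero_pow two_ne_zero]
    by_contra hne
    have := hsupp (subset_tsupport _ (Function.mem_support.2 hne))
    rw [mem_Icc] at this; rw [mem_Ico, not_and_or, not_le, not_lt] at hw
    rcases hw with hw | hw <;> linarith
  rw [← integral_indicator measurableSet_Ico]
  have e : (Ico (-c) (-c + L)).indicator (fun w ↦ ‖h (w + c - δ)‖ ^ 2) = fun w ↦ ‖h (w + (c - δ))‖ ^ 2 := by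
    funext w
    by_cases hw : w ∈ Ico (-c) (-c + L)
    · rw [Set.indicator_of_mem hw, add_sub_assoc]
    · rw [Set.indicator_of_notMem hw, ← add_sub_assoc, hvan w hw]
  rw [e, integral_add_right_eq_self (fun u : ℝ ↦ ‖h u‖ ^ 2) (c - δ)]

/-! ## §2  The comb's norm and its deleted perturbation, by fibres; its `Q_S`-cost by the parallelogram law -/

/-- **Norm of the comb**: `‖g_v‖₂² = (Σ_i v_i²)·‖h‖₂²`. -/
theorem integral_norm_sq_comb (hh : IsWeilTest h) (hsupp : tsupport h ⊆ Icc (-δ) δ) (hδ : 0 < δ) (hL : 2 * δ < L) {m : ℕ}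
    (hv : ∀ j, m < j → v j = 0) :
    ∫ u : ℝ, ‖∑ i ∈ Finset.range (m + 1), (v i : ℂ) * h (u + m * L / 2 - i * L)‖ ^ 2 =
      (∑ i ∈ Finset.range (m + 1), v i ^ 2) * ∫ u : ℝ, ‖h u‖ ^ 2 := by
  set c := m * L / 2 + δ with hc
  have hL0 : 0 < L := by linarith
  have hm : 2 * c < (m + 1) * L := by rw [hc]; linarith
  have hg := isWeilTest_comb hh v (m * L / 2) L m
  have hgs := tsupport_comb_subset hsupp hL0.le v (le_refl m)
  rw [integral_norm_sq_eq_sum_cells hg hgs hL0 hm, Finset.sum_mul]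
  refine Finset.sum_congr rfl fun i _ ↦ ?_
  have hcell : ∀ w ∈ Ico (-c) (-c + L), ‖∑ j ∈ Finset.range (m + 1), (v j : ℂ) * h (w + i * L + m * L / 2 - j * L)‖ ^ 2 =
      v i ^ 2 * ‖h (w + c - δ)‖ ^ 2 := fun w hw ↦ by
    rw [comb_apply_cell hsupp hL hv (by rwa [hc] at hw) i, norm_mul, mul_pow, Complex.norm_real, Real.norm_eq_abs, sq_abs, ← hc]
  rw [setIntegral_congr_fun measurableSet_Ico hcell, integral_const_mul, setIntegral_norm_sq_shift hsupp hL c]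

/-- **The deleted perturbation of the comb**: for `1 ≤ d`:  `k_g(dL) + k_g(−dL) = 2(Σ_i v_i v_{i+d})·‖h‖₂²`. -/
theorem weilConv_weilReflect_comb_add_neg (hh : IsWeilTest h) (hsupp : tsupport h ⊆ Icc (-δ) δ) (hδ : 0 < δ) (hL : 2 * δ < L)
    {m : ℕ} (hv : ∀ j, m < j → v j = 0) (d : ℕ) :
    let g := fun t ↦ ∑ i ∈ Finset.range (m + 1), (v i : ℂ) * h (t + m * L / 2 - i * L)
    weilConv g (weilReflect g) (d * L) + weilConv g (weilReflect g) (-(d * L)) =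
      ((2 * (∑ i ∈ Finset.range (m + 1), v i * v (i + d)) * ∫ u : ℝ, ‖h u‖ ^ 2 : ℝ) : ℂ) := by
  intro g
  set c := m * L / 2 + δ with hc
  have hL0 : 0 < L := by linarith
  have hm : 2 * c < (m + 1) * L := by rw [hc]; linarith
  have hg : IsWeilTest g := isWeilTest_comb hh v (m * L / 2) L m
  have hgs : tsupport g ⊆ Icc (-c) c := tsupport_comb_subset hsupp hL0.le v (le_refl m)
  have hneg : weilConv g (weilReflect g) (-(d * L)) =
      (((∑ i ∈ Finset.range (m + 1), v i * v (i + d)) * ∫ u : ℝ, ‖h u‖ ^ 2 : ℝ) : ℂ) := by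
    rw [weilConv_weilReflect_eq_sum_cells hg hgs hL0 hm, Complex.ofReal_mul, Complex.ofReal_sum, Finset.sum_mul]
    refine Finset.sum_congr rfl fun i _ ↦ ?_
    have hcell : ∀ w ∈ Ico (-c) (-c + L), g (w + i * L) * conj (g (w + i * L - -(d * L))) =
        (((v i * v (i + d)) * ‖h (w + c - δ)‖ ^ 2 : ℝ) : ℂ) := fun w hw ↦ by
      have hw' : w ∈ Ico (-(m * L / 2 + δ)) (-(m * L / 2 + δ) + L) := by rwa [hc] at hw
      have e1 : g (w + i * L) = (v i : ℂ) * h (w + c - δ) := by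
        rw [hc, ← comb_apply_cell hsupp hL hv hw' i]
      have e2 : g (w + i * L - -(d * L)) = (v (i + d) : ℂ) * h (w + c - δ) := by
        rw [hc, ← comb_apply_cell hsupp hL hv hw' (i + d)]
        exact Finset.sum_congr rfl fun j _ ↦ by push_cast; ring_nf
      rw [e1, e2, map_mul, Complex.conj_ofReal, ← Complex.normSq_eq_norm_sq]
      push_cast
      rw [← Complex.mul_conj]; ring
    rw [setIntegral_congr_fun measurableSet_Ico hcell, integral_complex_ofReal, integral_const_mul,
      setIntegral_norm_sq_shift hsupp hL c]
    push_cast; ring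
  have hpos : weilConv g (weilReflect g) (d * L) = conj (weilConv g (weilReflect g) (-(d * L))) := by
    rw [conj_weilConv_weilReflect_neg]
  rw [hpos, hneg, Complex.conj_ofReal]
  push_cast; ring

/-- **The comb costs at most `2^m` blocks per unit mass**: under `Q_S ≥ 0` on `C(mL/2 + δ)`, `h ∈ C(δ)`, `L ≥ 0`: for every `n ≤ m`,
`Re Q_S(Σ_{i≤n} v_i h(· + mL/2 − iL)) ≤ 2^n·(Σ_{i≤n} v_i²)·Re Q_S(h)`. -/
theorem re_weilSemilocalQuadratic_comb_le (hh : IsWeilTest h) (hsupp : tsupport h ⊆ Icc (-δ) δ) (hL : 0 ≤ L) {m : ℕ}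
    (hpos : WeilSemilocalPositivityOn S (m * L / 2 + δ)) (v : ℕ → ℝ) :
    ∀ n : ℕ, n ≤ m → (weilSemilocalQuadratic S fun t ↦ ∑ i ∈ Finset.range (n + 1), (v i : ℂ) * h (t + m * L / 2 - i * L)).re ≤
      2 ^ n * (∑ i ∈ Finset.range (n + 1), v i ^ 2) * (weilSemilocalQuadratic S h).re := by
  have hm0 : (0 : ℝ) ≤ m * L / 2 := by positivity
  -- local copies of two lemmas of `SemilocalDeletionToeplitzHalfRoom` (landed minutes earlier; no hub olean yet, so not importable here)
  have weilSemilocalQuadratic_smul_translate : ∀ (S : Finset ℕ) (h : ℝ → ℂ) (v a : ℝ),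
      weilSemilocalQuadratic S (fun t ↦ (v : ℂ) * h (t + a)) = ((v ^ 2 : ℝ) : ℂ) * weilSemilocalQuadratic S h := fun S h v a ↦ by
    rw [weilSemilocalQuadratic_const_mul, Complex.normSq_ofReal]
    unfold weilSemilocalQuadratic
    rw [weilConv_weilReflect_translate]; push_cast; ring
  have re_weilSemilocalQuadratic_add_le : ∀ {f g : ℝ → ℂ}, IsWeilTest f → IsWeilTest g →
      tsupport f ⊆ Icc (-(m * L / 2 + δ)) (m * L / 2 + δ) → tsupport g ⊆ Icc (-(m * L / 2 + δ)) (m * L / 2 + δ) →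
      (weilSemilocalQuadratic S (f + g)).re ≤ 2 * (weilSemilocalQuadratic S f).re + 2 * (weilSemilocalQuadratic S g).re := by
    intro f g hf hg hfs hgs
    have hng : IsWeilTest (-g) := by convert hg.const_mul (-1) using 1; funext t; simp
    have h1 := weilSemilocalQuadratic_add S hf hg
    have h2 := weilSemilocalQuadratic_add S hf hng
    have hQn : weilSemilocalQuadratic S (-g) = weilSemilocalQuadratic S g := by
      rw [show -g = fun t ↦ (-1 : ℂ) * g t by funext t; simp, weilSemilocalQuadratic_const_mul]; simp
    have hcl : weilConv f (weilReflect (-g)) = -weilConv f (weilReflect g) := by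
      rw [show weilReflect (-g) = fun t ↦ (-1 : ℂ) * weilReflect g t by funext t; simp [weilReflect], weilConv_const_mul_right]
      funext t; simp
    have hcr : weilConv (-g) (weilReflect f) = -weilConv g (weilReflect f) := by
      rw [show -g = fun t ↦ (-1 : ℂ) * g t by funext t; simp, weilConv_const_mul_left]; funext t; simp
    have hWn : ∀ K : ℝ → ℂ, weilSemilocalFunctional S (-K) = -weilSemilocalFunctional S K := fun K ↦ by
      rw [show -K = fun t ↦ (-1 : ℂ) * K t by funext t; simp, weilSemilocalFunctional_const_mul, neg_one_mul]
    rw [hQn, hcl, hcr, hWn, hWn] at h2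
    have hsupp' : tsupport (f + -g) ⊆ Icc (-(m * L / 2 + δ)) (m * L / 2 + δ) := by
      refine (isClosed_Icc.closure_subset_iff).2 fun t ht' ↦ ?_
      have ht : (f + -g) t ≠ 0 := Function.mem_support.1 ht'
      by_cases hft : f t = 0
      · exact hgs (subset_tsupport _ (Function.mem_support.2 (fun h0 ↦ ht (by simp [hft, h0]) : g t ≠ 0)))
      · exact hfs (subset_tsupport _ (Function.mem_support.2 hft))
    have h0 := hpos _ (hf.add hng) hsupp'
    have e := congrArg Complex.re h1
    have e2 := congrArg Complex.re h2
    simp only [Complex.add_re, Complex.neg_re] at e e2 h0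
    linarith
  have hQ0 : 0 ≤ (weilSemilocalQuadratic S h).re := hpos h hh (hsupp.trans (Icc_subset_Icc (by linarith) (by linarith)))
  have hblock : ∀ i : ℕ, (weilSemilocalQuadratic S fun t ↦ (v i : ℂ) * h (t + (m * L / 2 - i * L))).re =
      v i ^ 2 * (weilSemilocalQuadratic S h).re := fun i ↦ by
    rw [weilSemilocalQuadratic_smul_translate, Complex.re_ofReal_mul]
  intro n
  induction n with
  | zero =>
    intro _
    simp only [zero_add, Finset.range_one, Finset.sum_singleton, Nat.cast_zero, zero_mul, sub_zero, pow_zero, one_mul]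
    have := hblock 0
    simp only [Nat.cast_zero, zero_mul, sub_zero] at this
    rw [this]
  | succ n ih =>
    intro hn
    have hn' : n ≤ m := (Nat.le_succ n).trans hn
    have hF := isWeilTest_comb hh v (m * L / 2) L n
    have hFs := tsupport_comb_subset hsupp hL v hn'
    have hu : IsWeilTest fun t ↦ (v (n + 1) : ℂ) * h (t + (m * L / 2 - (n + 1 : ℕ) * L)) := (isWeilTest_translate hh _).const_mul _
    have hus : tsupport (fun t ↦ (v (n + 1) : ℂ) * h (t + (m * L / 2 - (n + 1 : ℕ) * L))) ⊆ Icc (-(m * L / 2 + δ)) (m * L / 2 + δ) :=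
      (isClosed_Icc.closure_subset_iff).2 fun t ht' ↦ by
        have ht := Function.mem_support.1 ht'
        have := hsupp (subset_tsupport _ (Function.mem_support.2 (right_ne_zero_of_mul ht)))
        have h1 : ((n + 1 : ℕ) : ℝ) ≤ m := by exact_mod_cast hn
        have h2 : (0 : ℝ) ≤ ((n + 1 : ℕ) : ℝ) := by positivity
        rw [mem_Icc] at this ⊢; constructor <;> nlinarith [this.1, this.2]
    have e : (fun t ↦ ∑ i ∈ Finset.range (n + 1 + 1), (v i : ℂ) * h (t + m * L / 2 - i * L)) =
        (fun t ↦ ∑ i ∈ Finset.range (n + 1), (v i : ℂ) * h (t + m * L / 2 - i * L)) +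
          fun t ↦ (v (n + 1) : ℂ) * h (t + (m * L / 2 - (n + 1 : ℕ) * L)) := by
      funext t; rw [Finset.sum_range_succ, Pi.add_apply]; push_cast; ring_nf
    rw [e]
    have hA := re_weilSemilocalQuadratic_add_le hF hu hFs hus
    have hB := ih hn'
    rw [hblock (n + 1)] at hA
    rw [Finset.sum_range_succ, pow_succ]
    have h2n : (1 : ℝ) ≤ 2 ^ n := one_le_pow₀ (by norm_num)
    have hsum : 0 ≤ ∑ i ∈ Finset.range (n + 1), v i ^ 2 := Finset.sum_nonneg fun i _ ↦ sq_nonneg _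
    nlinarith [hA, hB, mul_nonneg (mul_nonneg hsum (sq_nonneg (v (n + 1)))) hQ0, sq_nonneg (v (n + 1)),
      mul_nonneg (sq_nonneg (v (n + 1))) hQ0, mul_nonneg hsum hQ0]

/-! ## §3  The half-room law for `m` atoms and every comb -/

/-- **COMB TEST IN THE DELETED FORM.**  `p ∈ S` prime, `L = log p`, `1 ≤ m`, `h ∈ C(δ)` with `0 < δ`, `2δ < L`, `Q_S ≥ 0` on `C(mL/2 + δ)`,
coefficients `v` vanishing beyond `m`, and a constraint `P` holding on the positive multiples of the comb:
`λ_min(S∖{p}; mL/2 + δ; P)·|v|²‖h‖₂² ≤ 2^m|v|²·Re Q_S(h) + (vᵀA_m(p)v)·‖h‖₂²`,  `vᵀA_m(p)v = 2Σ_{d=1}^{m} (log p/√(p^d)) Σ_i v_i v_{i+d}`. -/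
theorem semilocalGroundEnergy_erase_comb_le (hh : IsWeilTest h) (hsupp : tsupport h ⊆ Icc (-δ) δ) (hδ0 : 0 < δ)
    (hp : p.Prime) (hpS : p ∈ S) {m : ℕ} (hδ : 2 * δ < Real.log p) (hv : ∀ j, m < j → v j = 0)
    (hpos : WeilSemilocalPositivityOn S (m * Real.log p / 2 + δ))
    (hP : ∀ a : ℝ, 0 < a → P fun t ↦ (a : ℂ) * ∑ i ∈ Finset.range (m + 1), (v i : ℂ) * h (t + m * Real.log p / 2 - i * Real.log p)) :
    semilocalGroundEnergy (S.erase p) P (m * Real.log p / 2 + δ) *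
        ((∑ i ∈ Finset.range (m + 1), v i ^ 2) * ∫ u : ℝ, ‖h u‖ ^ 2) ≤
      2 ^ m * (∑ i ∈ Finset.range (m + 1), v i ^ 2) * (weilSemilocalQuadratic S h).re +
        (2 * ∑ e ∈ Finset.range m, Real.log p / Real.sqrt ((p : ℝ) ^ (e + 1)) *
          ∑ i ∈ Finset.range (m + 1), v i * v (i + (e + 1))) * ∫ u : ℝ, ‖h u‖ ^ 2 := by
  set L := Real.log p with hLdef
  have hL0 : 0 < L := Real.log_pos (by exact_mod_cast hp.one_lt)
  set g := fun t ↦ ∑ i ∈ Finset.range (m + 1), (v i : ℂ) * h (t + m * L / 2 - i * L) with hgdef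
  have hg : IsWeilTest g := isWeilTest_comb hh v (m * L / 2) L m
  have hgs : tsupport g ⊆ Icc (-(m * L / 2 + δ)) (m * L / 2 + δ) := tsupport_comb_subset hsupp hL0.le v (le_refl m)
  have hR := semilocalGroundEnergy_mul_le_re (S := S.erase p) (P := P) hg hgs hP
  have hm : 2 * (m * L / 2 + δ) < (m + 1) * Real.log p := by rw [← hLdef]; linarith
  have hid := weilSemilocalQuadratic_sub_erase_pow hg hp hpS hgs hm
  have hk : ∀ e ∈ Finset.range m, ((Real.log p / Real.sqrt ((p : ℝ) ^ (e + 1)) : ℝ) : ℂ) *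
      (weilConv g (weilReflect g) ((e + 1) * Real.log p) + weilConv g (weilReflect g) (-((e + 1) * Real.log p))) =
      ((Real.log p / Real.sqrt ((p : ℝ) ^ (e + 1)) *
        ((2 * ∑ i ∈ Finset.range (m + 1), v i * v (i + (e + 1))) * ∫ u : ℝ, ‖h u‖ ^ 2) : ℝ) : ℂ) := by
    intro e _
    have := weilConv_weilReflect_comb_add_neg hh hsupp hδ0 hδ hv (e + 1) (L := L) (m := m)
    rw [← hLdef, show ((e : ℝ) + 1) * L = ((e + 1 : ℕ) : ℝ) * L by push_cast; ring, this]
    push_cast; ring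
  rw [Finset.sum_congr rfl hk] at hid
  have hre := congrArg Complex.re hid
  rw [Complex.sub_re, Complex.neg_re, ← Complex.ofReal_sum, Complex.ofReal_re] at hre
  have hcost := re_weilSemilocalQuadratic_comb_le hh hsupp hL0.le hpos v m (le_refl m)
  rw [integral_norm_sq_comb hh hsupp hδ0 hδ hv] at hR
  have hsum : ∑ e ∈ Finset.range m, Real.log p / Real.sqrt ((p : ℝ) ^ (e + 1)) *
      ((2 * ∑ i ∈ Finset.range (m + 1), v i * v (i + (e + 1))) * ∫ u : ℝ, ‖h u‖ ^ 2) =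
      (2 * ∑ e ∈ Finset.range m, Real.log p / Real.sqrt ((p : ℝ) ^ (e + 1)) *
        ∑ i ∈ Finset.range (m + 1), v i * v (i + (e + 1))) * ∫ u : ℝ, ‖h u‖ ^ 2 := by
    rw [Finset.mul_sum, Finset.sum_mul]
    exact Finset.sum_congr rfl fun e _ ↦ by ring
  rw [hsum] at hre
  linarith

/-- **THE `(m+1)`-BLOCK HALF-ROOM LAW, all sectors, any comb.**  `p ∈ S` prime, `0 < δ`, `2δ < log p`, `Q_S ≥ 0` on `C(m·log p/2 + δ)`, and
`v` not identically zero on `{0,…,m}` (vanishing beyond):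
`λ_min(S∖{p}; m·log p/2 + δ)·|v|² ≤ vᵀA_m(p)v + 2^m·|v|²·λ_min(S; δ)`.  With `v` the bottom eigenvector of `A_m(p)` this is
`λ_min(S∖p) ≤ λ_min(A_m(p)) + 2^m·ε^S(δ)`; with any `v`, an explicit upper end. -/
theorem semilocalGroundEnergy_erase_top_le_comb (hp : p.Prime) (hpS : p ∈ S) {m : ℕ} (hδ0 : 0 < δ) (hδ : 2 * δ < Real.log p)
    (hpos : WeilSemilocalPositivityOn S (m * Real.log p / 2 + δ)) (hv : ∀ j, m < j → v j = 0)
    (hv0 : 0 < ∑ i ∈ Finset.range (m + 1), v i ^ 2) :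
    semilocalGroundEnergy (S.erase p) (fun _ ↦ True) (m * Real.log p / 2 + δ) * ∑ i ∈ Finset.range (m + 1), v i ^ 2 ≤
      2 * ∑ e ∈ Finset.range m, Real.log p / Real.sqrt ((p : ℝ) ^ (e + 1)) * ∑ i ∈ Finset.range (m + 1), v i * v (i + (e + 1)) +
        2 ^ m * (∑ i ∈ Finset.range (m + 1), v i ^ 2) * semilocalGroundEnergy S (fun _ ↦ True) δ := by
  set N := ∑ i ∈ Finset.range (m + 1), v i ^ 2 with hN
  set A := 2 * ∑ e ∈ Finset.range m, Real.log p / Real.sqrt ((p : ℝ) ^ (e + 1)) *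
    ∑ i ∈ Finset.range (m + 1), v i * v (i + (e + 1)) with hA
  set E := semilocalGroundEnergy (S.erase p) (fun _ ↦ True) (m * Real.log p / 2 + δ) with hE
  have h2m : (0 : ℝ) < 2 ^ m := by positivity
  have key : (E * N - A) / (2 ^ m * N) ≤ semilocalGroundEnergy S (fun _ ↦ True) δ := by
    refine le_semilocalGroundEnergy (semilocalSphereValues_top_nonempty S hδ0) fun g hg hs _ hn ↦ ?_
    have := semilocalGroundEnergy_erase_comb_le (P := fun _ ↦ True) hg hs hδ0 hp hpS hδ hv hpos fun _ _ ↦ trivial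
    rw [hn, mul_one, mul_one, ← hN, ← hA, ← hE] at this
    rw [div_le_iff₀ (by positivity)]
    nlinarith [this]
  have := (div_le_iff₀ (by positivity : (0 : ℝ) < 2 ^ m * N)).1 key
  nlinarith [this]

/-! ## §4  Sectors: reversal-symmetric combs keep the block's parity, antisymmetric combs flip it -/

/-- **Parity of a comb.** If `v` is reversal-SYMMETRIC (`v_i = v_{m−i}`) the comb of an even block is even and of an odd block odd; if `v` is
reversal-ANTISYMMETRIC (`v_i = −v_{m−i}`) the parities flip.  (The bottom eigenvector of `A_m(p)` is symmetric for even `m` and antisymmetric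
for odd `m` — the data's alternating «fast sector».) -/
theorem comb_neg_apply {m : ℕ} (s : ℝ) (hvs : ∀ i, i ≤ m → v (m - i) = s * v i) (σ : ℂ) (hh : ∀ t, h (-t) = σ * h t) (t : ℝ) :
    ∑ i ∈ Finset.range (m + 1), (v i : ℂ) * h (-t + m * L / 2 - i * L) =
      (s : ℂ) * σ * ∑ i ∈ Finset.range (m + 1), (v i : ℂ) * h (t + m * L / 2 - i * L) := by
  rw [Finset.mul_sum, ← Finset.sum_range_reflect _ (m + 1)]
  refine Finset.sum_congr rfl fun i hi ↦ ?_
  have him : i ≤ m := Nat.lt_succ_iff.1 (Finset.mem_range.1 hi)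
  have e1 : m + 1 - 1 - i = m - i := by omega
  have e2 : ((m - i : ℕ) : ℝ) = m - i := by push_cast [Nat.cast_sub him]; ring
  rw [e1, hvs i him, e2, show -t + m * L / 2 - (m - i : ℝ) * L = -(t + m * L / 2 - i * L) by ring, hh]
  push_cast; ring

/-- The half-room law in a SECTOR: coefficients with `v_{m−i} = s·v_i` (`s = ±1`: reversal-symmetric / antisymmetric), blocks of parity `σ = ±1`;
the comb then lies in the sector `sσ`; so `λ_min(S∖p; m·log p/2 + δ; parity sσ)·|v|² ≤ vᵀA_m(p)v + 2^m|v|²·λ_min(S; δ; parity σ)`. -/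
theorem semilocalGroundEnergy_erase_sector_le_comb (hp : p.Prime) (hpS : p ∈ S) {m : ℕ} (hδ0 : 0 < δ) (hδ : 2 * δ < Real.log p)
    (hpos : WeilSemilocalPositivityOn S (m * Real.log p / 2 + δ)) (hv : ∀ j, m < j → v j = 0)
    (hv0 : 0 < ∑ i ∈ Finset.range (m + 1), v i ^ 2) {s σ : ℝ} (hσ : σ = 1 ∨ σ = -1)
    (hvs : ∀ i, i ≤ m → v (m - i) = s * v i) :
    semilocalGroundEnergy (S.erase p) (fun g ↦ ∀ t, g (-t) = ((s * σ : ℝ) : ℂ) * g t) (m * Real.log p / 2 + δ) *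
        ∑ i ∈ Finset.range (m + 1), v i ^ 2 ≤
      2 * ∑ e ∈ Finset.range m, Real.log p / Real.sqrt ((p : ℝ) ^ (e + 1)) * ∑ i ∈ Finset.range (m + 1), v i * v (i + (e + 1)) +
        2 ^ m * (∑ i ∈ Finset.range (m + 1), v i ^ 2) *
          semilocalGroundEnergy S (fun g ↦ ∀ t, g (-t) = ((σ : ℝ) : ℂ) * g t) δ := by
  set N := ∑ i ∈ Finset.range (m + 1), v i ^ 2 with hN
  set A := 2 * ∑ e ∈ Finset.range m, Real.log p / Real.sqrt ((p : ℝ) ^ (e + 1)) *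
    ∑ i ∈ Finset.range (m + 1), v i * v (i + (e + 1)) with hA
  set E := semilocalGroundEnergy (S.erase p) (fun g ↦ ∀ t, g (-t) = ((s * σ : ℝ) : ℂ) * g t) (m * Real.log p / 2 + δ) with hE
  have hne : (semilocalSphereValues S (fun g ↦ ∀ t, g (-t) = ((σ : ℝ) : ℂ) * g t) δ).Nonempty := by
    rcases hσ with rfl | rfl
    · simpa using semilocalSphereValues_even_nonempty S hδ0
    · have := semilocalSphereValues_odd_nonempty S hδ0
      convert this using 3; simp
  have key : (E * N - A) / (2 ^ m * N) ≤ semilocalGroundEnergy S (fun g ↦ ∀ t, g (-t) = ((σ : ℝ) : ℂ) * g t) δ := by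
    refine le_semilocalGroundEnergy hne fun g hg hgs hPg hn ↦ ?_
    have := semilocalGroundEnergy_erase_comb_le (P := fun g ↦ ∀ t, g (-t) = ((s * σ : ℝ) : ℂ) * g t) hg hgs hδ0 hp hpS hδ hv hpos
      fun a _ t ↦ by
        show (a : ℂ) * ∑ i ∈ Finset.range (m + 1), (v i : ℂ) * g (-t + m * Real.log p / 2 - i * Real.log p) = _
        rw [comb_neg_apply s hvs (σ : ℂ) hPg t]; push_cast; ring
    rw [hn, mul_one, mul_one, ← hN, ← hA, ← hE] at this
    rw [div_le_iff₀ (by positivity)]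
    nlinarith [this]
  have := (div_le_iff₀ (by positivity : (0 : ℝ) < 2 ^ m * N)).1 key
  nlinarith [this]

end Summit.RiemannHypothesis.RiemannHypothesis.Theorems.SemilocalDeletionToeplitzCombs

end
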